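import Summits.BirchSwinnertonDyer.BirchSwinnertonDyer.Theses.ByReductionTypeAtTwo
import HarnessLib

/-!
# Route `ByReductionTypeAtTwo` (rung K4): the W-42 (β) split glue `RankOneAtTwoGlue` PROVED

Item `stmt-BirchSwinnertonDyer-23717` of route `route-BirchSwinnertonDyer-ByReductionTypeAtTwo`
(`Theses/ByReductionTypeAtTwo.lean`, support, rank 603): the glue of the split (gen 1) of the crux
`RankOneAtTwo` (item 19099: non-CM `E/ℚ` of analytic rank one ⇒ `BSD₂(E)`) into the SLICE
`RankOneAtTwoBigImageOddLocal` (item 23715: surjective mod-`2^n` Galois representation for every `n`,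
odd torsion order, odd Tamagawa product — the population of the cell `bsd-f1-sign2` Euler-system line
`fkl`) and its honest COMPLEMENT `RankOneAtTwoOffBigImageOddLocal` (item 23716: the negation of that
conjunction).  The glue `RankOneAtTwoBigImageOddLocal → RankOneAtTwoOffBigImageOddLocal → RankOneAtTwo`
is pure logic — excluded middle on the slice conjunction — and is the planner's sketch
(`pub/bsd-f1-sign2/data-es/SplitGlue-19099.lean`, `rankOneAtTwo_of_bigImageOddLocal_of_off`) landed
verbatim against the glue item; the converse direction (parent ⇒ each child) is recorded in the same
file, so the split is certified lossless:
`RankOneAtTwo ↔ (RankOneAtTwoBigImageOddLocal ∧ RankOneAtTwoOffBigImageOddLocal)`.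

Nothing is assumed: no named fact, no hypothesis beyond the item's own statement.  BSD is not proved
by any of this; the two children carry all the content.
-/

set_option autoImplicit false
set_option linter.dupNamespace false

namespace Summit.BirchSwinnertonDyer.BirchSwinnertonDyer.Theorems

open Summit.BirchSwinnertonDyer.BirchSwinnertonDyer.Theses.ByReductionTypeAtTwo in
/-- **Item `RankOneAtTwoGlue` of route `ByReductionTypeAtTwo` holds**: the big-image/odd-local slice
and its complement together give `RankOneAtTwo`, by cases on the slice conjunction
`(∀ n, surjective mod 2^n) ∧ Odd torsionOrder ∧ Odd tamagawaProduct`. -/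
theorem byReductionTypeAtTwo_rankOneAtTwoGlue_proof :
    Summit.BirchSwinnertonDyer.BirchSwinnertonDyer.Theses.ByReductionTypeAtTwo.RankOneAtTwoGlue := by
  unfold RankOneAtTwoGlue RankOneAtTwoBigImageOddLocal RankOneAtTwoOffBigImageOddLocal RankOneAtTwo
  intro hBig hOff W _ _ hcm han
  by_cases h : (∀ n : ℕ, W.HasSurjectiveModNGaloisRep ((2 ^ n : ℕ) : ℤ)) ∧ Odd W.torsionOrder ∧
      Odd W.tamagawaProduct
  · exact hBig W hcm h.1 h.2.1 h.2.2 han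
  · exact hOff W hcm h han

open Summit.BirchSwinnertonDyer.BirchSwinnertonDyer.Theses.ByReductionTypeAtTwo in
/-- The parent gives the slice child (drop the three slice hypotheses). -/
theorem byReductionTypeAtTwo_rankOneAtTwoBigImageOddLocal_of_rankOneAtTwo
    (h : RankOneAtTwo) : RankOneAtTwoBigImageOddLocal :=
  fun W _ _ hcm _ _ _ han => h W hcm han

open Summit.BirchSwinnertonDyer.BirchSwinnertonDyer.Theses.ByReductionTypeAtTwo in
/-- The parent gives the complement child (drop the negated conjunction). -/
theorem byReductionTypeAtTwo_rankOneAtTwoOffBigImageOddLocal_of_rankOneAtTwo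
    (h : RankOneAtTwo) : RankOneAtTwoOffBigImageOddLocal :=
  fun W _ _ hcm _ han => h W hcm han

open Summit.BirchSwinnertonDyer.BirchSwinnertonDyer.Theses.ByReductionTypeAtTwo in
/-- The W-42 (β) split of `RankOneAtTwo` is lossless: parent ⟺ slice ∧ complement. -/
theorem byReductionTypeAtTwo_rankOneAtTwo_iff_bigImageOddLocal_and_off :
    RankOneAtTwo ↔ (RankOneAtTwoBigImageOddLocal ∧ RankOneAtTwoOffBigImageOddLocal) :=
  ⟨fun h => ⟨byReductionTypeAtTwo_rankOneAtTwoBigImageOddLocal_of_rankOneAtTwo h,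
      byReductionTypeAtTwo_rankOneAtTwoOffBigImageOddLocal_of_rankOneAtTwo h⟩,
    fun h => byReductionTypeAtTwo_rankOneAtTwoGlue_proof h.1 h.2⟩

end Summit.BirchSwinnertonDyer.BirchSwinnertonDyer.Theorems
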